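import Summits.AnomalousDissipation.AnomalousDissipation.Theorems.TwohalfdNeg.Negative.LaminarShear

/-!
# Negative knowledge for the crux `TwohalfdNeg` (stmt-AnomalousDissipation-0211), IV: the energy ceiling
# cannot be relaxed to `O(ν⁻¹)` — Galilean-swept steady shear states

Certified copy of §7 of the cdisprove work file `Cruxes/TwohalfdNeg/Disproof.lean` (cycle 2).  Quantitative
sharpening of `twohalfdNeg_false_without_energyBound` (`Negative/LoadBearing.lean`): with the SAME fixed force
`f = (0,0,cos 2πx₀)`, the crux with its energy ceiling relaxed to `∃ E, ∀ j, meanEnergy (u j) ≤ E / ν j` is FALSE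
(`twohalfdNeg_false_energyInvNu`).  Witnesses: the steady Galilean-SWEPT shear states
`sweptState m z = (m, 0, 2 Re (z e^{2πix₀}))`, classical NS solutions with zero pressure and force `(0,0,cos 2πx₀)`
exactly when `(4π²ν + 2πm i) z = 1/2` (`isClassicalNSSolutionOn_swept` via `Torus.isClassicalNSSolutionOn_twoHalf`),
hence global Leray–Hopf, with honest means `meanEnergy = m² + 2|z|²`, `meanDissipation = 8π²ν|z|²`; along
`ν_j = (j+1)⁻²`, `m_j = √ν_j`: energy `≤ 2/ν_j`, dissipation `≥ 1/(2+8π²)`.  A proof of the crux must therefore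
exploit the energy bound at the scale `E ≪ ν⁻¹`.  Supports stmt-AnomalousDissipation-0211.
-/

noncomputable section

namespace Summit.AnomalousDissipation.AnomalousDissipation.Theorems.TwohalfdNeg.Negative

open MeasureTheory Set Filter Topology UnitAddTorus
open scoped ENNReal NNReal InnerProductSpace ComplexConjugate
open Literature.Analysis.FunctionSpaces Literature.Analysis.FunctionSpaces.Torus
open Literature.Analysis.FluidPDE Literature.Analysis.FluidPDE.Torus

/-! ## 7. Galilean-swept steady shear states: the energy ceiling cannot be relaxed to `O(ν⁻¹)` -/

section SweptProfile

/-- `reTrigPoly S c` depends only on the coefficients on `S`. [folklore] -/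
theorem reTrigPoly_congr {S : Finset (Fin 2 → ℤ)} {c c' : (Fin 2 → ℤ) → ℂ} (h : ∀ k ∈ S, c k = c' k) :
    reTrigPoly S c = reTrigPoly S c' := by
  funext x
  rw [reTrigPoly_eq_sum, reTrigPoly_eq_sum]
  exact Finset.sum_congr rfl fun k hk => by rw [h k hk]

/-- Additivity of `reTrigPoly S c x` in the coefficient family. [folklore] -/
theorem reTrigPoly_add_apply (S : Finset (Fin 2 → ℤ)) (c c' : (Fin 2 → ℤ) → ℂ) (x : (UnitAddTorus (Fin 2))) :
    reTrigPoly S (fun k => c k + c' k) x = reTrigPoly S c x + reTrigPoly S c' x := by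
  simp only [reTrigPoly_eq_sum, mul_add, Complex.add_re, Finset.sum_add_distrib]

/-- Real homogeneity of `reTrigPoly S c x` in the coefficient family. [folklore] -/
theorem reTrigPoly_ofReal_mul_apply (S : Finset (Fin 2 → ℤ)) (r : ℝ) (c : (Fin 2 → ℤ) → ℂ) (x : (UnitAddTorus (Fin 2))) :
    reTrigPoly S (fun k => (r : ℂ) * c k) x = r * reTrigPoly S c x := by
  simp only [reTrigPoly_eq_sum, Finset.mul_sum]
  refine Finset.sum_congr rfl fun k _ => ?_
  rw [mul_left_comm, Complex.re_ofReal_mul]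

/-- The phase-carrying coefficient family of the first planar mode: `z` on `{k₀ > 0}`, `conj z` on
`{k₀ < 0}`, `Re z` on `{k₀ = 0}` (conjugate symmetric for EVERY `z : ℂ`). [folklore] -/
def swCoef (z : ℂ) (k : (Fin 2 → ℤ)) : ℂ :=
  if 0 < k 0 then z else if k 0 < 0 then conj z else ((z.re : ℝ) : ℂ)

/-- `swCoef z` is conjugate symmetric. [folklore] -/
theorem isConjSymmScalar_swCoef (z : ℂ) : IsConjSymmScalar (swCoef z) := by
  intro k
  simp only [swCoef, Pi.neg_apply, Left.neg_pos_iff, Left.neg_neg_iff]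
  rcases lt_trichotomy (k 0) 0 with h | h | h
  · rw [if_pos h, if_neg (not_lt.2 h.le), if_pos h, Complex.conj_conj]
  · simp [h, Complex.conj_ofReal]
  · rw [if_neg (not_lt.2 h.le), if_pos h, if_pos h]

/-- Value at `e₀`. [folklore] -/
@[simp] theorem swCoef_modeFreq (z : ℂ) : swCoef z (modeFreq 0) = z := by
  simp [swCoef]

/-- Value at `-e₀`. [folklore] -/
@[simp] theorem swCoef_neg_modeFreq (z : ℂ) : swCoef z (-modeFreq 0) = conj z := by
  simp [swCoef]

/-- `swCoef` of a real number is the constant family. [folklore] -/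
theorem swCoef_ofReal (a : ℝ) : swCoef (a : ℂ) = fun _ => (a : ℂ) := by
  funext k
  simp only [swCoef, Complex.conj_ofReal, Complex.ofReal_re]
  split_ifs <;> rfl

/-- `swCoef` is additive. [folklore] -/
theorem swCoef_add (z w : ℂ) : swCoef (z + w) = fun k => swCoef z k + swCoef w k := by
  funext k
  simp only [swCoef, map_add, Complex.add_re, Complex.ofReal_add]
  split_ifs <;> rfl

/-- `swCoef` commutes with real scalars. [folklore] -/
theorem swCoef_ofReal_mul (r : ℝ) (z : ℂ) : swCoef ((r : ℂ) * z) = fun k => (r : ℂ) * swCoef z k := by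
  funext k
  simp only [swCoef, map_mul, Complex.conj_ofReal, Complex.re_ofReal_mul, Complex.ofReal_mul]
  split_ifs <;> rfl

/-- The swept profile `y ↦ 2 Re (z e^{2πi y₀})` (amplitude AND phase encoded in `z`). [folklore] -/
def sprofile (z : ℂ) : (UnitAddTorus (Fin 2)) → ℝ :=
  reTrigPoly (modeSet 0) (swCoef z)

/-- Swept profiles are smooth. [folklore] -/
theorem isSmooth_sprofile (z : ℂ) : IsSmooth (sprofile z) := isSmooth_reTrigPoly _ _
/-- Swept profiles are continuous. [folklore] -/
theorem continuous_sprofile (z : ℂ) : Continuous (sprofile z) := continuous_reTrigPoly _ _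

/-- Additivity in `z`. [folklore] -/
theorem sprofile_add (z w : ℂ) (y : (UnitAddTorus (Fin 2))) : sprofile (z + w) y = sprofile z y + sprofile w y := by
  rw [sprofile, swCoef_add, reTrigPoly_add_apply]
  rfl

/-- Real homogeneity in `z`. [folklore] -/
theorem sprofile_ofReal_mul (r : ℝ) (z : ℂ) (y : (UnitAddTorus (Fin 2))) : sprofile ((r : ℂ) * z) y = r * sprofile z y := by
  rw [sprofile, swCoef_ofReal_mul, reTrigPoly_ofReal_mul_apply]
  rfl

/-- A real amplitude gives back the cosine profile: `sprofile a = profile 0 (2a)`, in particular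
`sprofile (1/2) = profile 0 1 = cos 2πy₀`. [folklore] -/
theorem sprofile_one_half : sprofile (((1 : ℝ) / 2 : ℝ) : ℂ) = profile 0 1 := by
  rw [sprofile, swCoef_ofReal]
  rfl

/-- `∂₀` acts on swept profiles as multiplication of the amplitude by `2πi`. [folklore] -/
theorem partialDeriv_zero_sprofile (z : ℂ) (y : (UnitAddTorus (Fin 2))) :
    Torus.partialDeriv 0 (sprofile z) y = sprofile (2 * Real.pi * Complex.I * z) y := by
  rw [sprofile, partialDeriv_reTrigPoly, sprofile]
  refine congrFun (reTrigPoly_congr fun k hk => ?_) y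
  simp only [modeSet, Finset.mem_insert, Finset.mem_singleton] at hk
  rcases hk with rfl | rfl
  · simp [swCoef]
  · rw [swCoef_neg_modeFreq, swCoef_neg_modeFreq]
    simp only [Pi.neg_apply, modeFreq_apply_zero, Nat.cast_zero, zero_add, Int.cast_neg, Int.cast_one,
      smul_eq_mul, map_mul, Complex.conj_ofReal, Complex.conj_I, map_ofNat]
    ring

/-- The Laplacian acts on swept profiles as multiplication by `-4π²`. [folklore] -/
theorem laplacian_sprofile (z : ℂ) (y : (UnitAddTorus (Fin 2))) :
    Torus.laplacian (sprofile z) y = -(4 * Real.pi ^ 2) * sprofile z y := by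
  rw [sprofile, laplacian_reTrigPoly]
  have h : reTrigPoly (modeSet 0) (fun k => ((-(4 * Real.pi ^ 2 * freqNormSq k) : ℝ) : ℂ) • swCoef z k) =
      reTrigPoly (modeSet 0) (fun k => ((-(4 * Real.pi ^ 2) : ℝ) : ℂ) * swCoef z k) := by
    refine reTrigPoly_congr fun k hk => ?_
    rw [freqNormSq_of_mem_modeSet hk, smul_eq_mul]
    simp
  rw [h, reTrigPoly_ofReal_mul_apply]

/-- `∫ (sprofile z)² = 2|z|²`. [folklore] -/
theorem integral_sprofile_sq (z : ℂ) : ∫ y, sprofile z y ^ 2 = 2 * ‖z‖ ^ 2 := by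
  rw [sprofile, integral_sq_reTrigPoly (neg_mem_modeSet 0) (isConjSymmScalar_swCoef z), modeSet,
    Finset.sum_pair (modeFreq_ne_neg 0), swCoef_modeFreq, swCoef_neg_modeFreq, Complex.norm_conj]
  ring

/-- `∫ ‖∇ sprofile z‖² = 8π²|z|²`. [folklore] -/
theorem integral_norm_sq_gradient_sprofile (z : ℂ) :
    ∫ y, ‖Torus.gradient (sprofile z) y‖ ^ 2 = 8 * Real.pi ^ 2 * ‖z‖ ^ 2 := by
  rw [sprofile, integral_norm_sq_gradient_reTrigPoly (neg_mem_modeSet 0) (isConjSymmScalar_swCoef z), modeSet,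
    Finset.sum_pair (modeFreq_ne_neg 0), swCoef_modeFreq, swCoef_neg_modeFreq, Complex.norm_conj,
    freqNormSq_modeFreq]
  have h : freqNormSq (-modeFreq 0) = (((0 : ℕ) : ℝ) + 1) ^ 2 :=
    freqNormSq_of_mem_modeSet (n := 0) (by simp [modeSet])
  rw [h]
  simp
  ring

end SweptProfile

/-! ### The uniform planar drift and the swept steady states -/

section SweptState

/-- The uniform planar drift `y ↦ (m, 0)`. [folklore] -/
def drift (m : ℝ) : (UnitAddTorus (Fin 2)) → (EuclideanSpace ℝ (Fin 2)) := fun _ => EuclideanSpace.single 0 m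

/-- The drift is smooth. [folklore] -/
theorem isSmooth_drift (m : ℝ) : IsSmooth (drift m) := isSmooth_const _
/-- The drift is continuous. [folklore] -/
theorem continuous_drift (m : ℝ) : Continuous (drift m) := continuous_const

/-- The drift is divergence free. [folklore] -/
theorem isDivFree_drift (m : ℝ) : IsDivFree (drift m) := fun x => by
  simp [Torus.divergence, Torus.partialDeriv, Torus.lineDeriv, drift]

/-- `(V·∇)V = 0` for the uniform drift. [folklore] -/
theorem convect_drift (m : ℝ) (y : (UnitAddTorus (Fin 2))) : Torus.convect (drift m) (drift m) y = 0 := by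
  have h : liftAt (drift m) y = fun _ => EuclideanSpace.single 0 m := rfl
  simp [Torus.convect, Torus.fderiv, h]

/-- `ΔV = 0` for the uniform drift. [folklore] -/
theorem laplacian_drift (m : ℝ) (y : (UnitAddTorus (Fin 2))) : Torus.laplacian (drift m) y = 0 := by
  have h : liftAt (drift m) y = fun _ => EuclideanSpace.single 0 m := rfl
  simp only [Torus.laplacian, h]
  rw [InnerProductSpace.laplacian_const]
  rfl

/-- The drift has vanishing gradient norm. [folklore] -/
theorem gradNormSq_drift (m : ℝ) : gradNormSq (drift m) = 0 := by
  simp [gradNormSq, Torus.partialDeriv, Torus.lineDeriv, drift]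

/-- `∫ ‖(m,0)‖² = m²`. [folklore] -/
theorem integral_norm_sq_drift (m : ℝ) : ∫ y, ‖drift m y‖ ^ 2 = m ^ 2 := by
  simp [drift]

/-- `(m,0)·∇R = m ∂₀R` for smooth planar scalars. [folklore] -/
theorem inner_drift_gradient {R : (UnitAddTorus (Fin 2)) → ℝ} (hR : IsSmooth R) (m : ℝ) (y : (UnitAddTorus (Fin 2))) :
    ⟪drift m y, Torus.gradient R y⟫_ℝ = m * Torus.partialDeriv 0 R y := by
  rw [drift, EuclideanSpace.inner_single_left, gradient_apply (hR.isContDiff (by simp))]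
  simp

/-- **The Galilean-swept steady shear state** `x ↦ (m, 0, 2 Re (z e^{2πi x₀}))`: uniform planar drift
plus a phase-shifted vertical cosine shear. [folklore] -/
def sweptState (m : ℝ) (z : ℂ) : (UnitAddTorus (Fin 3)) → (EuclideanSpace ℝ (Fin 3)) := twoHalf (drift m) (sprofile z)

/-- Swept states are `x₃`-invariant. [folklore] -/
theorem sweptState_add_single (m : ℝ) (z : ℂ) (s : UnitAddCircle) (x : (UnitAddTorus (Fin 3))) :
    sweptState m z (x + Pi.single (2 : Fin 3) s) = sweptState m z x := by
  rw [sweptState, twoHalf_eq_comp, Function.comp_apply, Function.comp_apply]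
  exact comp_planarProj_add_single (fun y => planarEmbed (drift m y, sprofile z y)) s x

/-- The complex symbol of the swept advection–diffusion operator on the first mode:
`4π²ν + 2πm i` (diffusion + Doppler shift). [folklore] -/
def sweptDen (ν m : ℝ) : ℂ := ((4 * Real.pi ^ 2 * ν : ℝ) : ℂ) + ((2 * Real.pi * m : ℝ) : ℂ) * Complex.I

/-- The swept amplitude solving `(4π²ν + 2πm i) z = 1/2` (response of the first mode to the unit cosine source). [folklore] -/
def sweptAmp (ν m : ℝ) : ℂ := (((1 : ℝ) / 2 : ℝ) : ℂ) / sweptDen ν m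

/-- The symbol does not vanish for `ν ≠ 0`. [folklore] -/
theorem sweptDen_ne_zero {ν : ℝ} (hν : ν ≠ 0) (m : ℝ) : sweptDen ν m ≠ 0 := fun h => by
  have h2 : (sweptDen ν m).re = 4 * Real.pi ^ 2 * ν := by
    simp only [sweptDen, Complex.add_re, Complex.ofReal_re, Complex.mul_re, Complex.I_re, Complex.I_im,
      Complex.ofReal_im, mul_zero, zero_mul, sub_zero, add_zero]
  rw [h, Complex.zero_re] at h2
  exact mul_ne_zero (mul_ne_zero four_ne_zero (pow_ne_zero 2 Real.pi_ne_zero)) hν h2.symm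

/-- The amplitude relation `(4π²ν + 2πm i) · sweptAmp ν m = 1/2`. [folklore] -/
theorem sweptDen_mul_sweptAmp {ν : ℝ} (hν : ν ≠ 0) (m : ℝ) :
    sweptDen ν m * sweptAmp ν m = (((1 : ℝ) / 2 : ℝ) : ℂ) := by
  rw [sweptAmp, mul_div_cancel₀ _ (sweptDen_ne_zero hν m)]

/-- `|sweptAmp ν m|² = (1/4) / ((4π²ν)² + (2πm)²)`. [folklore] -/
theorem norm_sq_sweptAmp (ν m : ℝ) :
    ‖sweptAmp ν m‖ ^ 2 = (1 / 4) / ((4 * Real.pi ^ 2 * ν) ^ 2 + (2 * Real.pi * m) ^ 2) := by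
  rw [sweptAmp, norm_div, div_pow, Complex.norm_real, Real.norm_of_nonneg (by norm_num : (0 : ℝ) ≤ 1 / 2),
    Complex.sq_norm (sweptDen ν m), sweptDen, Complex.normSq_add_mul_I]
  norm_num

/-- **The residual force of the swept ansatz is the FIXED unit cosine shear force** `(0,0,cos 2πx₀) = shear 0 1`
whenever `(4π²ν + 2πm i) z = 1/2`: planar part `∂ₜV + (V·∇)V - νΔV + ∇0 = 0`, vertical part
`m ∂₀R - νΔR = 2 Re ((2πm i + 4π²ν) z e^{2πiy₀}) = cos 2πy₀`. [folklore] -/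
theorem twoHalfForce_swept {ν m : ℝ} {z : ℂ} (hz : sweptDen ν m * z = (((1 : ℝ) / 2 : ℝ) : ℂ)) :
    twoHalfForce univ ν (fun _ => drift m) (fun _ => sprofile z) (fun _ _ => (0 : ℝ)) = fun _ => shear 0 1 := by
  funext t x
  rw [twoHalfForce_apply, shear]
  have h1 : (fun y => Literature.Analysis.FunctionSpaces.Torus.timeDerivWithin univ (fun _ : ℝ => drift m) t y +
      Torus.convect ((fun _ : ℝ => drift m) t) ((fun _ : ℝ => drift m) t) y -
      ν • Torus.laplacian ((fun _ : ℝ => drift m) t) y +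
      Torus.gradient ((fun _ _ => (0 : ℝ)) t) y) = (0 : (UnitAddTorus (Fin 2)) → (EuclideanSpace ℝ (Fin 2))) := by
    funext y
    simp only [timeDerivWithin_const_fun, convect_drift, laplacian_drift, gradient_zero₂, smul_zero]
    simp
  have h2 : (fun y => Literature.Analysis.FunctionSpaces.Torus.timeDerivWithin univ (fun _ : ℝ => sprofile z) t y +
      ⟪((fun _ : ℝ => drift m) t) y, Torus.gradient ((fun _ : ℝ => sprofile z) t) y⟫_ℝ -
      ν * Torus.laplacian ((fun _ : ℝ => sprofile z) t) y) = profile 0 1 := by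
    funext y
    simp only [timeDerivWithin_const_fun, zero_add]
    rw [inner_drift_gradient (isSmooth_sprofile z), partialDeriv_zero_sprofile, laplacian_sprofile,
      ← sprofile_one_half, ← hz, sweptDen, add_mul, sprofile_add, sprofile_ofReal_mul,
      mul_assoc (((2 * Real.pi * m : ℝ) : ℂ)) Complex.I z, sprofile_ofReal_mul]
    rw [show (2 * (Real.pi : ℂ) * Complex.I * z) = ((2 * Real.pi : ℝ) : ℂ) * (Complex.I * z) by push_cast; ring,
      sprofile_ofReal_mul]
    ring
  rw [h1, h2]

/-- **The swept state is a classical steady Navier–Stokes solution** with viscosity `ν`, zero pressure and the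
fixed force `shear 0 1` (packaging theorem `Torus.isClassicalNSSolutionOn_twoHalf`). [folklore] -/
theorem isClassicalNSSolutionOn_swept {ν m : ℝ} {z : ℂ} (hz : sweptDen ν m * z = (((1 : ℝ) / 2 : ℝ) : ℂ)) :
    IsClassicalNSSolutionOn univ ν (fun _ => shear 0 1) (fun _ => sweptState m z)
      (fun _ => (fun _ : (UnitAddTorus (Fin 2)) => (0 : ℝ)) ∘ planarProj) := by
  have hV : IsSmoothSpaceTimeOn univ (fun _ : ℝ => drift m) := isSmoothSpaceTimeOn_const (isSmooth_drift m) _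
  have hR : IsSmoothSpaceTimeOn univ (fun _ : ℝ => sprofile z) := isSmoothSpaceTimeOn_const (isSmooth_sprofile z) _
  have hφ : IsSmoothSpaceTimeOn univ (fun _ : ℝ => fun _ : (UnitAddTorus (Fin 2)) => (0 : ℝ)) :=
    isSmoothSpaceTimeOn_const (isSmooth_const (0 : ℝ)) _
  have hcl := isClassicalNSSolutionOn_twoHalf uniqueDiffOn_univ ν hV hR hφ (fun _ _ => isDivFree_drift m)
  rw [twoHalfForce_swept hz] at hcl
  exact hcl

/-- **The swept state is a global Leray–Hopf solution for the fixed force `shear 0 1`.** [folklore] -/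
theorem isGlobalLerayHopf_swept {ν m : ℝ} {z : ℂ} (hz : sweptDen ν m * z = (((1 : ℝ) / 2 : ℝ) : ℂ)) :
    IsGlobalLerayHopf ν (fun _ => shear 0 1) (sweptState m z) (fun _ => sweptState m z) :=
  (isClassicalNSSolutionOn_swept hz).isGlobalLerayHopf

/-- Slice energy `∫‖(m,0,R)‖² = m² + 2|z|²`. [folklore] -/
theorem integral_norm_sq_sweptState (m : ℝ) (z : ℂ) : ∫ x, ‖sweptState m z x‖ ^ 2 = m ^ 2 + 2 * ‖z‖ ^ 2 := by
  rw [sweptState, integral_norm_sq_twoHalf (continuous_drift m) (continuous_sprofile z), integral_sprofile_sq,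
    integral_norm_sq_drift]

/-- **Mean energy of the swept state** (honest, constant in time): `m² + 2|z|²`. [folklore] -/
theorem meanEnergy_sweptState (m : ℝ) (z : ℂ) : meanEnergy (fun _ : ℝ => sweptState m z) = m ^ 2 + 2 * ‖z‖ ^ 2 := by
  rw [meanEnergy_eq_longTimeAvgSup]
  simp_rw [integral_norm_sq_sweptState]
  exact longTimeAvgSup_const_fun _

/-- Dissipation of the swept state (spectral form): `8π²|z|²` (the drift carries no gradient). [folklore] -/
theorem toReal_eGradNormSq_sweptState (m : ℝ) (z : ℂ) :
    (eGradNormSq (sweptState m z)).toReal = 8 * Real.pi ^ 2 * ‖z‖ ^ 2 := by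
  rw [sweptState, toReal_eGradNormSq_twoHalf (isSmooth_drift m) (isSmooth_sprofile z), gradNormSq_drift, zero_add,
    scalarGradNormSq, integral_norm_sq_gradient_sprofile]

/-- **Mean dissipation of the swept state** (honest): `8π²ν|z|²`. [folklore] -/
theorem meanDissipation_sweptState (ν m : ℝ) (z : ℂ) :
    meanDissipation ν (fun _ : ℝ => sweptState m z) = ν * (8 * Real.pi ^ 2 * ‖z‖ ^ 2) := by
  unfold meanDissipation
  simp_rw [toReal_eGradNormSq_sweptState]
  exact longTimeAvgSup_const_fun _

end SweptState

/-! ### The energy ceiling cannot be relaxed to `O(ν⁻¹)` -/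

section Threshold

/-- Real arithmetic: the swept dissipation `2π²/(4π² + 16π⁴q)` is at least `1/(2+8π²)` for `q ≤ 1`. [folklore] -/
theorem swept_dissipation_lower {q : ℝ} (hq0 : 0 < q) (hq1 : q ≤ 1) :
    1 / (2 + 8 * Real.pi ^ 2) ≤ q * (8 * Real.pi ^ 2 * (1 / 4 / ((4 * Real.pi ^ 2 * q) ^ 2 + 4 * Real.pi ^ 2 * q))) := by
  have hπ : 0 < Real.pi ^ 2 := by positivity
  have h : q * (8 * Real.pi ^ 2 * (1 / 4 / ((4 * Real.pi ^ 2 * q) ^ 2 + 4 * Real.pi ^ 2 * q))) =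
      2 * Real.pi ^ 2 / (16 * Real.pi ^ 4 * q + 4 * Real.pi ^ 2) := by
    field_simp
    ring
  rw [h, div_le_div_iff₀ (by positivity) (by positivity)]
  nlinarith [mul_le_mul_of_nonneg_left hq1 (by positivity : (0 : ℝ) ≤ 16 * Real.pi ^ 4)]

/-- Real arithmetic: the swept energy `q + (1/2)/(16π⁴q² + 4π²q)` is at most `2/q` for `0 < q ≤ 1`. [folklore] -/
theorem swept_energy_upper {q : ℝ} (hq0 : 0 < q) (hq1 : q ≤ 1) :
    q + 2 * (1 / 4 / ((4 * Real.pi ^ 2 * q) ^ 2 + 4 * Real.pi ^ 2 * q)) ≤ 2 / q := by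
  have hπ : 3 < Real.pi := Real.pi_gt_three
  have h1 : q ≤ 1 / q := by
    rw [le_div_iff₀ hq0]
    nlinarith
  have hπ2 : 1 ≤ Real.pi ^ 2 := by nlinarith
  have h2 : 2 * (1 / 4 / ((4 * Real.pi ^ 2 * q) ^ 2 + 4 * Real.pi ^ 2 * q)) ≤ 1 / q := by
    rw [← mul_div_assoc, div_le_div_iff₀ (by positivity) hq0]
    nlinarith [sq_nonneg (4 * Real.pi ^ 2 * q), mul_le_mul_of_nonneg_right hπ2 hq0.le]
  calc q + 2 * (1 / 4 / ((4 * Real.pi ^ 2 * q) ^ 2 + 4 * Real.pi ^ 2 * q)) ≤ 1 / q + 1 / q := add_le_add h1 h2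
    _ = 2 / q := by ring

/-- `TwohalfdNeg` with the energy ceiling RELAXED from `O(1)` to `O(ν_j⁻¹)` — `∃ E, ∀ j, meanEnergy (u j) ≤ E / ν j`
(everything else verbatim: ONE fixed steady smooth solenoidal mean-zero `x₃`-invariant force, `ν_j → 0`,
`x₃`-invariant global Leray–Hopf families). -/
def TwohalfdNegEnergyInvNu : Prop :=
  ∀ f : (UnitAddTorus (Fin 3)) → (EuclideanSpace ℝ (Fin 3)), (∀ (s : UnitAddCircle) (x : (UnitAddTorus (Fin 3))), f (x + Pi.single (2 : Fin 3) s) = f x) →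
    IsSmooth f → IsDivFree f → HasZeroMean f →
    ∀ (ν : ℕ → ℝ) (u₀ : ℕ → (UnitAddTorus (Fin 3)) → (EuclideanSpace ℝ (Fin 3))) (u : ℕ → ℝ → (UnitAddTorus (Fin 3)) → (EuclideanSpace ℝ (Fin 3))),
      (∀ j, 0 < ν j) → Tendsto ν atTop (𝓝 0) →
      (∀ j, IsGlobalLerayHopf (ν j) (fun _ => f) (u₀ j) (u j)) →
      (∀ j (t : ℝ) (s : UnitAddCircle) (x : (UnitAddTorus (Fin 3))), u j t (x + Pi.single (2 : Fin 3) s) = u j t x) →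
      (∃ E : ℝ, ∀ j, meanEnergy (u j) ≤ E / ν j) →
      Tendsto (fun j => meanDissipation (ν j) (u j)) atTop (𝓝 0)

/-- **THE ENERGY CEILING CANNOT BE RELAXED TO `O(ν⁻¹)` — quantitative sharpening of
`twohalfdNeg_false_without_energyBound`.**  Witness, for the SAME fixed force `f = (0,0,cos 2πx₀)` as there:
`ν_j = (j+1)⁻²`, and the steady Galilean-SWEPT shear states `u_j = (m_j, 0, 2 Re (z_j e^{2πix₀}))` with planar
drift `m_j = (j+1)⁻¹ = √ν_j` and amplitude `z_j = ½/(4π²ν_j + 2πm_j i)` (classical steady NS solutions: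
`m ∂₀w = ν ∂₀₀w + cos 2πx₀`; global Leray–Hopf, `x₃`-invariant).  Their mean energy is
`m_j² + 2|z_j|² = ν_j + ½/(16π⁴ν_j² + 4π²ν_j) ≤ 2/ν_j`, while their mean dissipation is
`8π²ν_j|z_j|² = 2π²/(16π⁴ν_j + 4π²) ≥ 1/(2+8π²)` at every level.  Reading: at zero drift the laminar response to a
fixed force has energy `∝ ν⁻²` (the §4 witness); a drift of size `√ν` Doppler-detunes the forced mode just enough to
cap the energy at `O(ν⁻¹)` while the dissipation `= ν × 4π² × (scalar energy)` stays `O(1)`.  Along the same family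
with drift `m_j = ν_j^b`: energy `~ ν^{-2b}`, dissipation `~ ν^{1-2b}` — the ceiling exponent `-1` is the exact
threshold in the laminar world (`b < ½` ⇒ dissipation `→ 0`).  HENCE a proof of the crux must exploit the energy
bound at the scale `E ≪ ν⁻¹`; any argument that would survive `meanEnergy ≤ E/ν_j` is refuted by this family
(bounds of the shape `D ≲ (ν E)^a` are consistent).  The witnesses carry planar momentum `m_j → 0`. [folklore] -/
theorem twohalfdNeg_false_energyInvNu : ¬ TwohalfdNegEnergyInvNu := by
  intro h
  set q : ℕ → ℝ := fun j => (1 / ((j : ℝ) + 1)) ^ 2 with hq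
  have hq0 : ∀ j, 0 < q j := fun j => by positivity
  have hq1 : ∀ j, q j ≤ 1 := fun j => by
    have hj : (1 : ℝ) ≤ (j : ℝ) + 1 := by
      have := (Nat.cast_nonneg j : (0 : ℝ) ≤ j)
      linarith
    simp only [hq, div_pow, one_pow]
    exact div_le_one_of_le₀ (by nlinarith) (by positivity)
  have hν0 : Tendsto q atTop (𝓝 0) := by
    show Tendsto (fun j : ℕ => (1 / ((j : ℝ) + 1)) ^ 2) atTop (𝓝 0)
    simpa using (tendsto_one_div_add_atTop_nhds_zero_nat (𝕜 := ℝ)).pow 2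
  have hz : ∀ j, sweptDen (q j) (1 / ((j : ℝ) + 1)) * sweptAmp (q j) (1 / ((j : ℝ) + 1)) = (((1 : ℝ) / 2 : ℝ) : ℂ) :=
    fun j => sweptDen_mul_sweptAmp (hq0 j).ne' _
  have hsq : ∀ j : ℕ, (2 * Real.pi * (1 / ((j : ℝ) + 1))) ^ 2 = 4 * Real.pi ^ 2 * q j := fun j => by
    simp only [hq]
    ring
  have ht := h (shear 0 1) (shear_add_single 0 1) (isSmooth_shear 0 1) (isDivFree_shear 0 1)
    (hasZeroMean_shear 0 1) q (fun j => sweptState (1 / ((j : ℝ) + 1)) (sweptAmp (q j) (1 / ((j : ℝ) + 1))))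
    (fun j _ => sweptState (1 / ((j : ℝ) + 1)) (sweptAmp (q j) (1 / ((j : ℝ) + 1)))) hq0 hν0
    (fun j => isGlobalLerayHopf_swept (hz j)) (fun j _ s x => sweptState_add_single _ _ s x)
    ⟨2, fun j => by
      rw [meanEnergy_sweptState, norm_sq_sweptAmp, hsq]
      have he : (1 / ((j : ℝ) + 1)) ^ 2 = q j := rfl
      rw [he]
      exact swept_energy_upper (hq0 j) (hq1 j)⟩
  refine not_tendsto_zero_of_le (c := 1 / (2 + 8 * Real.pi ^ 2)) (by positivity) (fun j => ?_) ht
  rw [meanDissipation_sweptState, norm_sq_sweptAmp, hsq]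
  exact swept_dissipation_lower (hq0 j) (hq1 j)

end Threshold

end Summit.AnomalousDissipation.AnomalousDissipation.Theorems.TwohalfdNeg.Negative

end
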